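import Summits.CriticalPhenomena.SAWScalingLimit.Theorems.SAWDevelopingMapHexTightPerShellAtoms
import HarnessLib

/-!
# The boundary atom of `HexTight` has no aspect-ratio content; its one-threshold rate form (stmt-CriticalPhenomena-5423)

Crux `Summit.CriticalPhenomena.SAWScalingLimit.Theses.SAWDevelopingMap.HexTight`, line `reversal-virgin-disc`, skeleton
r8 (seat c3), stub `stub_onFrontierPerShellTight` = the boundary atom `OnFrontierPerShellTight`: per-shell, rate-free
tightness (as the mesh `δ → 0`) of the number of separate traversals, by the critical hexagonal SAW polyline of
`(Ω_δ; a δ, b δ)`, of a THIN shell `D(x; ρ, R)` (`0 < ρ`, `4ρ < R ≤ 1`) centred at a point `x` of the Jordan curve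
`frontier Ω`. The atom itself is a verbatim piece of the crux (`perShellTight_of_hexTight`) and is research-open
(no a-priori boundary multi-arm estimate for the critical SAW is known). This file records what CAN be proved about
it with the tree's plane geometry (net localization with thresholds, `Curve.exists_net_hasTraversals_of_hasTraversals`;
moving a near-boundary centre onto the frontier, `exists_frontier_near`; confinement of SAW polylines):

* `perShellTight_thin_of_net` — MASTER LOCALIZATION about an arbitrary centre: given thin-interior per-shell
  tightness, the `Σ_j k_j`-traversal probability of `D(x; ρ, R)` is at most `η₁ + M β` as soon as, at the net scale
  `w = 2πm/M` (`m = (ρ+R)/2`, `88 w < hh = (R-ρ)/2`), every shell `D(x''; 11w, hh/2)` centred ON the frontier has a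
  threshold with traversal probability `≤ β`: each net shell `D(c_j; w, hh - w)` is interior (`closedBall c_j (8w) ⊆ Ω`:
  the interior atom at tolerance `η₁/M`), or has its inner ball off `closure Ω` (empty event), or sits within `10w`
  of a frontier point `x''` (`Curve.HasTraversals.mono`).
* `perShellTight_thin_of_onFrontierAspect`, `onFrontierAspect_of_onFrontier` — **NO ASPECT CONTENT**: for any
  `c ≥ 4`, thin-interior per-shell tightness + on-frontier per-shell tightness on the shells with `c ρ < R ≤ 1` ONLY ⇒
  per-shell tightness on every thin shell `4ρ < R ≤ 1` about every centre (net size `M ≍ c`, fixed before the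
  tolerance); the converse restriction is trivial, so given the interior atom the boundary atom at any ONE aspect ratio
  is equivalent to the boundary atom (and, by `perShellTight_of_hexTight`, still a piece of the crux).
* `perShellTight_thin_of_onFrontierDecay` — **ONE-THRESHOLD RATE FORM** (the law-level boundary twin of the r8 interior
  atom `PinchDecay`; a SUFFICIENT form, not a piece of the crux): thin-interior per-shell tightness + `OnFrontierDecay`
  (for each outer radius `R ≤ 1` ONE threshold `k` and ONE rate `φ(ρ) = o(ρ)` with
  `P_δ(k separate traversals of D(x; ρ, R)) ≤ φ(ρ)` for every `x ∈ frontier Ω`, every `ρ < R/4` and `δ ≤ δ₁(x, ρ)`) ⇒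
  per-shell tightness on every thin shell (union bound `M φ(22πm/M) → 0`, exactly where `o(ρ)` is the minimal
  hypothesis). Heuristics for the critical SAW: one unforced excursion from distance `R` to distance `ρ` of a boundary
  point costs `(ρ/R)^2` on a smooth arc (boundary two-leg exponent `2`) but only `O(ρ/R)` at the tip of an inward slit
  (Beurling), so the expected threshold is "forced traversals `+ 4`" (two unforced excursions), rate `ρ²`; the forced
  number is bounded uniformly over the curve for fixed `R` (finitely many `(R-ρ)`-oscillations of a Jordan curve).
* `hexTight_of_interiorBound_one_of_onFrontierDecay` — the assembled reduction of the crux for the skeleton owner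
  (interior bound with some exponent `> 1`, e.g. the output of `Reversal.stub_virginizationTight`, plus
  `OnFrontierDecay`; the aspect form composes likewise through `hexTight_of_interiorBound_one_of_onFrontier`).

References: M. Aizenman, A. Burchard, Duke Math. J. 99 (1999) §1.a–b, §3.a [AizenmanBurchardDuke1999];
H. Duminil-Copin, S. Smirnov, Ann. of Math. 175 (2012) §4 [DuminilCopinSmirnov2012].
-/

noncomputable section

open scoped BigOperators Classical ENNReal
open MeasureTheory Filter Topology Set Metric
open Literature.Probability.LatticeModels Literature.Probability.RandomPlanarGeometry
  Literature.Probability.RandomPlanarGeometry.SAW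

namespace Summit.CriticalPhenomena.SAWScalingLimit.Theorems.HexTight.BoundaryOnFrontier

open Summit.CriticalPhenomena.SAWScalingLimit.Theorems.HexTight.ExponentBootstrap

/-! ### Master localization: interior atom inside, frontier control at the net scale -/

/-- **Master net localization about an arbitrary centre.** Let `Ω` be open with thin-interior per-shell tightness of
the traversal number (`0 < ρ'`, `4ρ' < R' ≤ 1`, `closedBall x' R' ⊆ Ω`). Fix a thin shell `D(x; ρ, R)` (`0 < ρ`,
`4ρ < R ≤ 1`), write `m = (ρ+R)/2`, `hh = (R-ρ)/2`, and take a net size `M` with `176π m / hh < M` (net mesh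
`w = 2πm/M`, `88 w < hh`). If every shell `D(x''; 11w, hh/2)` centred at a frontier point `x''` has a threshold whose
traversal probability is `≤ β` at small meshes, then for every `η₁ > 0` the shell `D(x; ρ, R)` has a threshold whose
traversal probability is `≤ η₁ + M β` at small meshes. (Each of the `M` net shells `D(c_j; w, hh - w)` of
`Curve.exists_net_hasTraversals_of_hasTraversals` is interior — `closedBall c_j (8w) ⊆ Ω`, charge `η₁/M` by the
interior atom on `D(c_j; w, 8w)` —, or has `closedBall c_j w` off `closure Ω` — empty event —, or lies within `10w` of
a frontier point `x''` (`exists_frontier_near`) — charge `β` on `D(x''; 11w, hh/2) `; union bound.) -/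
theorem perShellTight_thin_of_net {Ω : Set ℂ} (hΩ : IsOpen Ω) {a b : ℝ → HexVertex}
    (hI : ∀ (x : ℂ) (ρ R : ℝ), 0 < ρ → 4 * ρ < R → R ≤ 1 → Metric.closedBall x R ⊆ Ω → ∀ η : ℝ, 0 < η →
      ∃ (k : ℕ) (δ₁ : ℝ), 0 < δ₁ ∧ ∀ δ ∈ Set.Ioc (0 : ℝ) δ₁, δ ≤ ρ →
        hexSAWLaw Ω δ (a δ) (b δ)
          {γ | (⟨γ.walk.toCurve fun v => (δ : ℂ) * hexCenter v⟩ : Curve ℂ).HasTraversals k x ρ R} ≤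
          ENNReal.ofReal η)
    {x : ℂ} {ρ R : ℝ} (hρ : 0 < ρ) (h4 : 4 * ρ < R) (hR1 : R ≤ 1) {M : ℕ}
    (hM : 176 * Real.pi * ((ρ + R) / 2) / ((R - ρ) / 2) < M) {β η₁ : ℝ} (hβ : 0 ≤ β) (hη₁ : 0 < η₁)
    (hF : ∀ x'' ∈ frontier Ω, ∃ (k : ℕ) (δ₁ : ℝ), 0 < δ₁ ∧ ∀ δ ∈ Set.Ioc (0 : ℝ) δ₁,
      δ ≤ 11 * (2 * Real.pi * ((ρ + R) / 2) / M) →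
        hexSAWLaw Ω δ (a δ) (b δ)
          {γ | (⟨γ.walk.toCurve fun v => (δ : ℂ) * hexCenter v⟩ : Curve ℂ).HasTraversals k x''
            (11 * (2 * Real.pi * ((ρ + R) / 2) / M)) ((R - ρ) / 4)} ≤ ENNReal.ofReal β) :
    ∃ (k : ℕ) (δ₁ : ℝ), 0 < δ₁ ∧ ∀ δ ∈ Set.Ioc (0 : ℝ) δ₁,
      hexSAWLaw Ω δ (a δ) (b δ)
        {γ | (⟨γ.walk.toCurve fun v => (δ : ℂ) * hexCenter v⟩ : Curve ℂ).HasTraversals k x ρ R} ≤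
        ENNReal.ofReal (η₁ + M * β) := by
  have hρR : ρ < R := by linarith
  -- middle radius `m`, half width `hh`, net mesh `w`
  set m : ℝ := (ρ + R) / 2 with hm
  set hh : ℝ := (R - ρ) / 2 with hhh
  set w : ℝ := 2 * Real.pi * m / M with hw
  have hmpos : 0 < m := by rw [hm]; linarith
  have hhpos : 0 < hh := by rw [hhh]; linarith
  have hh1 : hh ≤ 1 / 2 := by rw [hhh]; linarith
  have hquot : 0 ≤ 176 * Real.pi * m / hh := by positivity
  have hMpos : (0 : ℝ) < M := hquot.trans_lt hM
  have hM0 : M ≠ 0 := by rintro rfl; simp at hMpos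
  have hM1 : 1 ≤ M := Nat.one_le_iff_ne_zero.2 hM0
  have hMne : (M : ℝ) ≠ 0 := hMpos.ne'
  have hwpos : 0 < w := by rw [hw]; positivity
  have h88 : 88 * w < hh := by
    have h1 : 176 * Real.pi * m < M * hh := by
      have := (div_lt_iff₀ hhpos).1 hM; linarith [mul_comm (M : ℝ) hh]
    rw [hw, show 88 * (2 * Real.pi * m / M) = 176 * Real.pi * m / M by ring, div_lt_iff₀ hMpos]
    linarith [mul_comm (M : ℝ) hh]
  have hquarter : (R - ρ) / 4 = hh / 2 := by rw [hhh]; ring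
  -- net centres
  set c : ℕ → ℂ := fun j : ℕ => x + ((m : ℝ) : ℂ) *
      Complex.exp (((-Real.pi + 2 * Real.pi * (j : ℝ) / M : ℝ) : ℂ) * Complex.I) with hc
  -- the charge of one net point
  have key : ∀ j : ℕ, ∃ (kj : ℕ) (δj : ℝ), 0 < δj ∧ ∀ δ ∈ Set.Ioc (0 : ℝ) δj,
      hexSAWLaw Ω δ (a δ) (b δ)
        {γ | (⟨γ.walk.toCurve fun v => (δ : ℂ) * hexCenter v⟩ : Curve ℂ).HasTraversals kj (c j) w (hh - w)} ≤
        ENNReal.ofReal (η₁ / M) + ENNReal.ofReal β := by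
    intro j
    by_cases hA : Metric.closedBall (c j) (8 * w) ⊆ Ω
    · -- interior net shell `D(c j; w, 8w)`
      obtain ⟨k, δ₁, hδ₁, hk⟩ :=
        hI (c j) w (8 * w) hwpos (by linarith) (by linarith) hA (η₁ / M) (by positivity)
      refine ⟨k, min δ₁ w, lt_min hδ₁ hwpos, fun δ hδ => ?_⟩
      have hδ' : δ ∈ Set.Ioc (0 : ℝ) δ₁ := ⟨hδ.1, hδ.2.trans (min_le_left _ _)⟩
      have hδw : δ ≤ w := hδ.2.trans (min_le_right _ _)
      calc hexSAWLaw Ω δ (a δ) (b δ) _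
          ≤ hexSAWLaw Ω δ (a δ) (b δ)
              {γ | (⟨γ.walk.toCurve fun v => (δ : ℂ) * hexCenter v⟩ : Curve ℂ).HasTraversals k (c j) w (8 * w)} :=
            measure_mono fun γ hγ => Curve.HasTraversals.mono' hγ le_rfl (by linarith)
        _ ≤ ENNReal.ofReal (η₁ / M) := hk δ hδ' hδw
        _ ≤ ENNReal.ofReal (η₁ / M) + ENNReal.ofReal β := le_self_add
    · by_cases hB : Disjoint (Metric.closedBall (c j) w) (closure Ω)
      · -- inner ball off `closure Ω`: empty event at threshold `1`
        refine ⟨1, 1, one_pos, fun δ _ => ?_⟩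
        have hempty : {γ : HexDomainSAW Ω δ (a δ) (b δ) |
            (⟨γ.walk.toCurve fun v => (δ : ℂ) * hexCenter v⟩ : Curve ℂ).HasTraversals 1 (c j) w (hh - w)} = ∅ :=
          Set.eq_empty_of_forall_notMem fun γ hγ =>
            not_hasTraversals_one_of_disjoint hB (by linarith) γ hγ
        rw [hempty, measure_empty]
        exact bot_le
      · -- a frontier point `x''` within `10w` of `c j`
        obtain ⟨z, hzball, hzΩ⟩ := Set.not_subset.1 hA
        obtain ⟨y, hyball, hycl⟩ := Set.not_disjoint_iff.1 hB
        rw [Metric.mem_closedBall] at hyball hzball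
        rw [dist_comm] at hzball
        obtain ⟨x'', hx''fr, hx''d⟩ := exists_frontier_near hΩ hycl hyball hzΩ hzball
        obtain ⟨k, δ₁, hδ₁, hk⟩ := hF x'' hx''fr
        refine ⟨k, min δ₁ w, lt_min hδ₁ hwpos, fun δ hδ => ?_⟩
        have hδ' : δ ∈ Set.Ioc (0 : ℝ) δ₁ := ⟨hδ.1, hδ.2.trans (min_le_left _ _)⟩
        have hδw : δ ≤ 11 * w := (hδ.2.trans (min_le_right _ _)).trans (by linarith)
        calc hexSAWLaw Ω δ (a δ) (b δ) _
            ≤ hexSAWLaw Ω δ (a δ) (b δ)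
                {γ | (⟨γ.walk.toCurve fun v => (δ : ℂ) * hexCenter v⟩ : Curve ℂ).HasTraversals k x''
                  (11 * w) ((R - ρ) / 4)} := by
              refine measure_mono fun γ hγ => ?_
              have h1 : (⟨γ.walk.toCurve fun v => (δ : ℂ) * hexCenter v⟩ : Curve ℂ).HasTraversals k x''
                  (11 * w) (hh - 11 * w) :=
                Curve.HasTraversals.mono hγ (by linarith) (by linarith)
              rw [Set.mem_setOf_eq, hquarter]
              exact h1.mono' le_rfl (by linarith)
          _ ≤ ENNReal.ofReal β := hk δ hδ' hδw
          _ ≤ ENNReal.ofReal (η₁ / M) + ENNReal.ofReal β := le_add_self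
  choose kj δj hδj hkj using key
  -- a common mesh bound for the `M` net points
  obtain ⟨j₀, hj₀, hmin⟩ := (Finset.range M).exists_min_image δj ⟨0, Finset.mem_range.2 hM1⟩
  refine ⟨∑ j ∈ Finset.range M, kj j, min w (δj j₀), lt_min hwpos (hδj j₀), fun δ hδ => ?_⟩
  have hsub : {γ : HexDomainSAW Ω δ (a δ) (b δ) |
      (⟨γ.walk.toCurve fun v => (δ : ℂ) * hexCenter v⟩ : Curve ℂ).HasTraversals
        (∑ j ∈ Finset.range M, kj j) x ρ R} ⊆
      ⋃ j ∈ Finset.range M, {γ | (⟨γ.walk.toCurve fun v => (δ : ℂ) * hexCenter v⟩ : Curve ℂ).HasTraversals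
        (kj j) (c j) w (hh - w)} := by
    intro γ hγ
    obtain ⟨j, hj, hjT⟩ := Curve.exists_net_hasTraversals_of_hasTraversals hρ.le hρR hM1 (fun j => kj j) hγ
    refine Set.mem_iUnion₂.2 ⟨j, Finset.mem_range.2 hj, ?_⟩
    simpa only [hc, hw, hm, hhh, Set.mem_setOf_eq] using hjT
  have hper : ∀ j ∈ Finset.range M,
      hexSAWLaw Ω δ (a δ) (b δ) {γ | (⟨γ.walk.toCurve fun v => (δ : ℂ) * hexCenter v⟩ : Curve ℂ).HasTraversals
        (kj j) (c j) w (hh - w)} ≤ ENNReal.ofReal (η₁ / M) + ENNReal.ofReal β := fun j hj =>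
    hkj j δ ⟨hδ.1, (hδ.2.trans (min_le_right _ _)).trans (hmin j hj)⟩
  have htot : (M : ℝ≥0∞) * (ENNReal.ofReal (η₁ / M) + ENNReal.ofReal β) = ENNReal.ofReal (η₁ + M * β) := by
    rw [mul_add, ← ENNReal.ofReal_natCast M, ← ENNReal.ofReal_mul (Nat.cast_nonneg M),
      ← ENNReal.ofReal_mul (Nat.cast_nonneg M), mul_div_cancel₀ _ hMne,
      ← ENNReal.ofReal_add hη₁.le (by positivity)]
  calc hexSAWLaw Ω δ (a δ) (b δ) _
      ≤ hexSAWLaw Ω δ (a δ) (b δ) (⋃ j ∈ Finset.range M, {γ |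
          (⟨γ.walk.toCurve fun v => (δ : ℂ) * hexCenter v⟩ : Curve ℂ).HasTraversals
            (kj j) (c j) w (hh - w)}) := measure_mono hsub
    _ ≤ ∑ j ∈ Finset.range M, hexSAWLaw Ω δ (a δ) (b δ) {γ |
          (⟨γ.walk.toCurve fun v => (δ : ℂ) * hexCenter v⟩ : Curve ℂ).HasTraversals
            (kj j) (c j) w (hh - w)} := measure_biUnion_finset_le _ _
    _ ≤ ∑ j ∈ Finset.range M, (ENNReal.ofReal (η₁ / M) + ENNReal.ofReal β) := Finset.sum_le_sum hper
    _ = (M : ℝ≥0∞) * (ENNReal.ofReal (η₁ / M) + ENNReal.ofReal β) := by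
        rw [Finset.sum_const, Finset.card_range, nsmul_eq_mul]
    _ = ENNReal.ofReal (η₁ + M * β) := htot


/-! ### The boundary atom has no aspect-ratio content -/

/-- **On-frontier per-shell tightness at ONE aspect ratio suffices.** Let `Ω` be open and `c ≥ 4`. Thin-interior
per-shell tightness together with per-shell tightness of the traversal number on the shells `D(x; ρ, R)` with
`0 < ρ`, `c ρ < R ≤ 1` centred at points `x ∈ frontier Ω` ONLY gives per-shell tightness on every thin shell
`D(x; ρ, R)`, `0 < ρ`, `4ρ < R ≤ 1`, about EVERY centre `x` (in particular the boundary atom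
`OnFrontierPerShellTight` at aspect `4`): `perShellTight_thin_of_net` with the net size
`M = ⌈176πm/hh + 44πmc/hh⌉₊ + 1` (so that `c · 11w < hh/2`), fixed BEFORE the tolerance, charges `η/2` inside and
`η/(2M)` per frontier net shell. -/
theorem perShellTight_thin_of_onFrontierAspect :
    ∀ (c : ℝ), 4 ≤ c → ∀ (Ω : Set ℂ), IsOpen Ω → ∀ (a b : ℝ → HexVertex),
      (∀ (x : ℂ) (ρ R : ℝ), 0 < ρ → 4 * ρ < R → R ≤ 1 → Metric.closedBall x R ⊆ Ω → ∀ η : ℝ, 0 < η →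
        ∃ (k : ℕ) (δ₁ : ℝ), 0 < δ₁ ∧ ∀ δ ∈ Set.Ioc (0 : ℝ) δ₁, δ ≤ ρ →
          hexSAWLaw Ω δ (a δ) (b δ)
            {γ | (⟨γ.walk.toCurve fun v => (δ : ℂ) * hexCenter v⟩ : Curve ℂ).HasTraversals k x ρ R} ≤
            ENNReal.ofReal η) →
      (∀ (x : ℂ) (ρ R : ℝ), 0 < ρ → c * ρ < R → R ≤ 1 → x ∈ frontier Ω → ∀ η : ℝ, 0 < η →
        ∃ (k : ℕ) (δ₁ : ℝ), 0 < δ₁ ∧ ∀ δ ∈ Set.Ioc (0 : ℝ) δ₁, δ ≤ ρ →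
          hexSAWLaw Ω δ (a δ) (b δ)
            {γ | (⟨γ.walk.toCurve fun v => (δ : ℂ) * hexCenter v⟩ : Curve ℂ).HasTraversals k x ρ R} ≤
            ENNReal.ofReal η) →
      ∀ (x : ℂ) (ρ R : ℝ), 0 < ρ → 4 * ρ < R → R ≤ 1 → ∀ η : ℝ, 0 < η →
        ∃ (k : ℕ) (δ₁ : ℝ), 0 < δ₁ ∧ ∀ δ ∈ Set.Ioc (0 : ℝ) δ₁, δ ≤ ρ →
          hexSAWLaw Ω δ (a δ) (b δ)
            {γ | (⟨γ.walk.toCurve fun v => (δ : ℂ) * hexCenter v⟩ : Curve ℂ).HasTraversals k x ρ R} ≤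
            ENNReal.ofReal η := by
  intro c hc Ω hΩ a b hI hF x ρ R hρ h4 hR1 η hη
  set m : ℝ := (ρ + R) / 2 with hm
  set hh : ℝ := (R - ρ) / 2 with hhh
  have hmpos : 0 < m := by rw [hm]; linarith
  have hhpos : 0 < hh := by rw [hhh]; linarith
  have hh1 : hh ≤ 1 / 2 := by rw [hhh]; linarith
  have hc0 : 0 < c := by linarith
  -- the net size, fixed before the tolerance
  obtain ⟨M, hMdef⟩ : ∃ M : ℕ, M = ⌈176 * Real.pi * m / hh + 44 * Real.pi * m * c / hh⌉₊ + 1 := ⟨_, rfl⟩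
  have hMgt : 176 * Real.pi * m / hh + 44 * Real.pi * m * c / hh < M := by
    rw [hMdef]; push_cast
    linarith [Nat.le_ceil (176 * Real.pi * m / hh + 44 * Real.pi * m * c / hh)]
  have hq1 : 0 ≤ 176 * Real.pi * m / hh := by positivity
  have hq2 : 0 ≤ 44 * Real.pi * m * c / hh := by positivity
  have hM : 176 * Real.pi * m / hh < M := by linarith
  have hMpos : (0 : ℝ) < M := hq1.trans_lt hM
  have hMne : (M : ℝ) ≠ 0 := hMpos.ne'
  set w : ℝ := 2 * Real.pi * m / M with hw
  have hwpos : 0 < w := by rw [hw]; positivity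
  -- `c · 11 w < hh / 2`
  have hcw : c * (11 * w) < hh / 2 := by
    have h1 : 44 * Real.pi * m * c < M * hh := by
      have hMc : 44 * Real.pi * m * c / hh < M := by linarith
      have := (div_lt_iff₀ hhpos).1 hMc
      linarith [mul_comm (M : ℝ) hh]
    rw [hw, show c * (11 * (2 * Real.pi * m / M)) = 22 * Real.pi * m * c / M by ring, div_lt_iff₀ hMpos]
    nlinarith [mul_comm (M : ℝ) hh]
  have hquarter : (R - ρ) / 4 = hh / 2 := by rw [hhh]; ring
  -- frontier control at the net scale, tolerance `η/(2M)`
  have hFnet : ∀ x'' ∈ frontier Ω, ∃ (k : ℕ) (δ₁ : ℝ), 0 < δ₁ ∧ ∀ δ ∈ Set.Ioc (0 : ℝ) δ₁, δ ≤ 11 * w →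
      hexSAWLaw Ω δ (a δ) (b δ)
        {γ | (⟨γ.walk.toCurve fun v => (δ : ℂ) * hexCenter v⟩ : Curve ℂ).HasTraversals k x''
          (11 * w) ((R - ρ) / 4)} ≤ ENNReal.ofReal (η / (2 * M)) := by
    intro x'' hx''
    rw [hquarter]
    exact hF x'' (11 * w) (hh / 2) (by positivity) hcw (by linarith) hx'' (η / (2 * M)) (by positivity)
  obtain ⟨k, δ₁, hδ₁, hk⟩ := perShellTight_thin_of_net hΩ hI hρ h4 hR1 hM (by positivity : (0 : ℝ) ≤ η / (2 * M))
    (half_pos hη) hFnet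
  refine ⟨k, δ₁, hδ₁, fun δ hδ _ => (hk δ hδ).trans (le_of_eq ?_)⟩
  congr 1
  field_simp
  ring

/-- Conversely, the aspect-`c` on-frontier form is a restriction of the aspect-`4` form (`c ≥ 4`): given the interior
atom, on-frontier per-shell tightness at any single aspect ratio `c ≥ 4` is EQUIVALENT to the boundary atom
`OnFrontierPerShellTight` (`perShellTight_thin_of_onFrontierAspect` for the other direction). -/
theorem onFrontierAspect_of_onFrontier (c : ℝ) (hc : 4 ≤ c) {Ω : Set ℂ} {a b : ℝ → HexVertex}
    (hF : ∀ (x : ℂ) (ρ R : ℝ), 0 < ρ → 4 * ρ < R → R ≤ 1 → x ∈ frontier Ω → ∀ η : ℝ, 0 < η →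
      ∃ (k : ℕ) (δ₁ : ℝ), 0 < δ₁ ∧ ∀ δ ∈ Set.Ioc (0 : ℝ) δ₁, δ ≤ ρ →
        hexSAWLaw Ω δ (a δ) (b δ)
          {γ | (⟨γ.walk.toCurve fun v => (δ : ℂ) * hexCenter v⟩ : Curve ℂ).HasTraversals k x ρ R} ≤
          ENNReal.ofReal η) :
    ∀ (x : ℂ) (ρ R : ℝ), 0 < ρ → c * ρ < R → R ≤ 1 → x ∈ frontier Ω → ∀ η : ℝ, 0 < η →
      ∃ (k : ℕ) (δ₁ : ℝ), 0 < δ₁ ∧ ∀ δ ∈ Set.Ioc (0 : ℝ) δ₁, δ ≤ ρ →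
        hexSAWLaw Ω δ (a δ) (b δ)
          {γ | (⟨γ.walk.toCurve fun v => (δ : ℂ) * hexCenter v⟩ : Curve ℂ).HasTraversals k x ρ R} ≤
          ENNReal.ofReal η :=
  fun x ρ R hρ hcρ hR1 hx η hη => hF x ρ R hρ (lt_of_le_of_lt (by nlinarith) hcρ) hR1 hx η hη

/-! ### The one-threshold rate form of the boundary atom -/

/-- **Per-shell tightness from the interior atom and ON-FRONTIER DECAY.** Let `Ω` be open with thin-interior per-shell
tightness. Suppose `OnFrontierDecay`: for each outer radius `0 < R ≤ 1` there are ONE threshold `k` and ONE rate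
function `φ` with `φ(t) = o(t)` as `t → 0⁺` such that for every `x ∈ frontier Ω` and every `0 < ρ < R/4` the SAW polyline
makes `k` separate traversals of `D(x; ρ, R)` with probability `≤ φ(ρ)` at all meshes `δ ≤ δ₁(x, ρ)`, `δ ≤ ρ`. Then the
traversal number is tight on every thin shell `D(x; ρ, R)` (`0 < ρ`, `4ρ < R ≤ 1`) about every centre:
`perShellTight_thin_of_net` at the outer radius `hh/2`, with `ε (22πm + 1) = η/2`, `φ(t) ≤ ε t` on `(0, t₀]`, net size
`M = ⌈176πm/hh + 22πm/t₀⌉₊ + 1` (so `11w = 22πm/M ≤ t₀`), `β = ε · 11w ≥ φ(11w)`: the frontier net shells charge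
`M β = 22πm ε ≤ η/2` in total — the union bound closes exactly because `φ(t) = o(t)`. -/
theorem perShellTight_thin_of_onFrontierDecay :
    ∀ (Ω : Set ℂ), IsOpen Ω → ∀ (a b : ℝ → HexVertex),
      (∀ (x : ℂ) (ρ R : ℝ), 0 < ρ → 4 * ρ < R → R ≤ 1 → Metric.closedBall x R ⊆ Ω → ∀ η : ℝ, 0 < η →
        ∃ (k : ℕ) (δ₁ : ℝ), 0 < δ₁ ∧ ∀ δ ∈ Set.Ioc (0 : ℝ) δ₁, δ ≤ ρ →
          hexSAWLaw Ω δ (a δ) (b δ)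
            {γ | (⟨γ.walk.toCurve fun v => (δ : ℂ) * hexCenter v⟩ : Curve ℂ).HasTraversals k x ρ R} ≤
            ENNReal.ofReal η) →
      (∀ R : ℝ, 0 < R → R ≤ 1 → ∃ (k : ℕ) (φ : ℝ → ℝ),
        (∀ ε : ℝ, 0 < ε → ∃ t₀ : ℝ, 0 < t₀ ∧ ∀ t : ℝ, 0 < t → t ≤ t₀ → φ t ≤ ε * t) ∧
        ∀ x ∈ frontier Ω, ∀ ρ : ℝ, 0 < ρ → 4 * ρ < R →
          ∃ δ₁ : ℝ, 0 < δ₁ ∧ ∀ δ ∈ Set.Ioc (0 : ℝ) δ₁, δ ≤ ρ →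
            hexSAWLaw Ω δ (a δ) (b δ)
              {γ | (⟨γ.walk.toCurve fun v => (δ : ℂ) * hexCenter v⟩ : Curve ℂ).HasTraversals k x ρ R} ≤
              ENNReal.ofReal (φ ρ)) →
      ∀ (x : ℂ) (ρ R : ℝ), 0 < ρ → 4 * ρ < R → R ≤ 1 → ∀ η : ℝ, 0 < η →
        ∃ (k : ℕ) (δ₁ : ℝ), 0 < δ₁ ∧ ∀ δ ∈ Set.Ioc (0 : ℝ) δ₁, δ ≤ ρ →
          hexSAWLaw Ω δ (a δ) (b δ)
            {γ | (⟨γ.walk.toCurve fun v => (δ : ℂ) * hexCenter v⟩ : Curve ℂ).HasTraversals k x ρ R} ≤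
            ENNReal.ofReal η := by
  intro Ω hΩ a b hI hF x ρ R hρ h4 hR1 η hη
  set m : ℝ := (ρ + R) / 2 with hm
  set hh : ℝ := (R - ρ) / 2 with hhh
  have hmpos : 0 < m := by rw [hm]; linarith
  have hhpos : 0 < hh := by rw [hhh]; linarith
  have hh1 : hh ≤ 1 / 2 := by rw [hhh]; linarith
  have hquarter : (R - ρ) / 4 = hh / 2 := by rw [hhh]; ring
  -- the decay data at the outer radius `hh / 2`
  obtain ⟨k, φ, hφ, hdec⟩ := hF (hh / 2) (half_pos hhpos) (by linarith)
  obtain ⟨ε, hεdef⟩ : ∃ ε : ℝ, ε = η / (2 * (22 * Real.pi * m + 1)) := ⟨_, rfl⟩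
  have hεpos : 0 < ε := by rw [hεdef]; positivity
  have hεη : ε * (22 * Real.pi * m) ≤ η / 2 := by
    have h1 : ε * (22 * Real.pi * m + 1) = η / 2 := by rw [hεdef]; field_simp
    nlinarith
  obtain ⟨t₀, ht₀, hφt⟩ := hφ ε hεpos
  -- the net size
  obtain ⟨M, hMdef⟩ : ∃ M : ℕ, M = ⌈176 * Real.pi * m / hh + 22 * Real.pi * m / t₀⌉₊ + 1 := ⟨_, rfl⟩
  have hMgt : 176 * Real.pi * m / hh + 22 * Real.pi * m / t₀ < M := by
    rw [hMdef]; push_cast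
    linarith [Nat.le_ceil (176 * Real.pi * m / hh + 22 * Real.pi * m / t₀)]
  have hq1 : 0 ≤ 176 * Real.pi * m / hh := by positivity
  have hq2 : 0 ≤ 22 * Real.pi * m / t₀ := by positivity
  have hM : 176 * Real.pi * m / hh < M := by linarith
  have hMpos : (0 : ℝ) < M := hq1.trans_lt hM
  have hMne : (M : ℝ) ≠ 0 := hMpos.ne'
  set w : ℝ := 2 * Real.pi * m / M with hw
  have hwpos : 0 < w := by rw [hw]; positivity
  have h11w : 11 * w = 22 * Real.pi * m / M := by rw [hw]; ring
  -- `11 w ≤ t₀` and `88 w < hh`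
  have hwt₀ : 11 * w ≤ t₀ := by
    have h1 : 22 * Real.pi * m < M * t₀ := by
      have hMt : 22 * Real.pi * m / t₀ < M := by linarith
      have := (div_lt_iff₀ ht₀).1 hMt
      linarith [mul_comm (M : ℝ) t₀]
    rw [h11w, div_le_iff₀ hMpos]
    linarith [mul_comm (M : ℝ) t₀]
  have h88 : 88 * w < hh := by
    have h1 : 176 * Real.pi * m < M * hh := by
      have := (div_lt_iff₀ hhpos).1 hM; linarith [mul_comm (M : ℝ) hh]
    rw [hw, show 88 * (2 * Real.pi * m / M) = 176 * Real.pi * m / M by ring, div_lt_iff₀ hMpos]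
    linarith [mul_comm (M : ℝ) hh]
  -- frontier control at the net scale, charge `β = ε · 11 w ≥ φ (11 w)`
  have hβ : 0 ≤ ε * (11 * w) := by positivity
  have hFnet : ∀ x'' ∈ frontier Ω, ∃ (k' : ℕ) (δ₁ : ℝ), 0 < δ₁ ∧ ∀ δ ∈ Set.Ioc (0 : ℝ) δ₁, δ ≤ 11 * w →
      hexSAWLaw Ω δ (a δ) (b δ)
        {γ | (⟨γ.walk.toCurve fun v => (δ : ℂ) * hexCenter v⟩ : Curve ℂ).HasTraversals k' x''
          (11 * w) ((R - ρ) / 4)} ≤ ENNReal.ofReal (ε * (11 * w)) := by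
    intro x'' hx''
    obtain ⟨δ₁, hδ₁, hk⟩ := hdec x'' hx'' (11 * w) (by positivity) (by linarith)
    refine ⟨k, δ₁, hδ₁, fun δ hδ hδw => ?_⟩
    rw [hquarter]
    exact (hk δ hδ hδw).trans (ENNReal.ofReal_le_ofReal (hφt (11 * w) (by positivity) hwt₀))
  obtain ⟨k', δ₁, hδ₁, hk'⟩ := perShellTight_thin_of_net hΩ hI hρ h4 hR1 hM hβ (half_pos hη) hFnet
  refine ⟨k', δ₁, hδ₁, fun δ hδ _ => (hk' δ hδ).trans (ENNReal.ofReal_le_ofReal ?_)⟩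
  have h2 : (M : ℝ) * (ε * (11 * w)) = ε * (22 * Real.pi * m) := by
    rw [h11w]; field_simp
  linarith

/-! ### The assembled reductions of the crux -/

/-- **`HexTight` from an interior bound (exponent `> 1`) and ON-FRONTIER DECAY** (one threshold and one rate
`o(ρ)` per outer radius, uniformly over the Jordan curve — the boundary twin of the r8 interior atom `PinchDecay`).
(`interiorPerShellTight_of_interiorBound_one`, `perShellTight_thin_of_onFrontierDecay`,
`hexTight_of_interiorBound_one_of_onFrontier`.) -/
theorem hexTight_of_interiorBound_one_of_onFrontierDecay
    (hI : ∀ (D : DobrushinDomain) (a b : ℝ → HexVertex), IsEmbEndpointApprox hexGraph hexCenter D a b →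
      ∃ (k : ℂ → ℝ → ℝ → ℕ) (K lam δ₀ : ℝ), 0 ≤ K ∧ 1 < lam ∧ 0 < δ₀ ∧
        ∀ δ ∈ Set.Ioc (0 : ℝ) δ₀, ∀ (x : ℂ) (ρ R : ℝ), δ ≤ ρ → ρ < R → R ≤ 1 →
          Metric.closedBall x R ⊆ D.carrier →
          hexSAWLaw D.carrier δ (a δ) (b δ)
            {γ | (⟨γ.walk.toCurve fun v => (δ : ℂ) * hexCenter v⟩ : Curve ℂ).HasTraversals
              (k x ρ R) x ρ R} ≤ ENNReal.ofReal (K * (ρ / R) ^ lam))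
    (hF : ∀ (D : DobrushinDomain) (a b : ℝ → HexVertex), IsEmbEndpointApprox hexGraph hexCenter D a b →
      ∀ R : ℝ, 0 < R → R ≤ 1 → ∃ (k : ℕ) (φ : ℝ → ℝ),
        (∀ ε : ℝ, 0 < ε → ∃ t₀ : ℝ, 0 < t₀ ∧ ∀ t : ℝ, 0 < t → t ≤ t₀ → φ t ≤ ε * t) ∧
        ∀ x ∈ frontier D.carrier, ∀ ρ : ℝ, 0 < ρ → 4 * ρ < R →
          ∃ δ₁ : ℝ, 0 < δ₁ ∧ ∀ δ ∈ Set.Ioc (0 : ℝ) δ₁, δ ≤ ρ →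
            hexSAWLaw D.carrier δ (a δ) (b δ)
              {γ | (⟨γ.walk.toCurve fun v => (δ : ℂ) * hexCenter v⟩ : Curve ℂ).HasTraversals k x ρ R} ≤
              ENNReal.ofReal (φ ρ)) :
    Summit.CriticalPhenomena.SAWScalingLimit.Theses.SAWDevelopingMap.HexTight :=
  hexTight_of_interiorBound_one_of_onFrontier hI fun D a b hab x ρ R hρ h4 hR1 _ η hη =>
    perShellTight_thin_of_onFrontierDecay D.carrier D.isOpen a b
      (interiorPerShellTight_of_interiorBound_one D.carrier a b (hI D a b hab)) (hF D a b hab) x ρ R hρ h4 hR1 η hη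

end Summit.CriticalPhenomena.SAWScalingLimit.Theorems.HexTight.BoundaryOnFrontier

end
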